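import Literature.Computability.Complexity.LazySampling
import Literature.Computability.Complexity.OracleClockFst
import HarnessLib

/-!
# Runs of a transcript algorithm under a history-dependent STRING-valued answer rule

Trunk `Complexity`, companion of `Oracle.lean` (G01 transcript model: an oracle algorithm is a step
function `(input, answers so far) ↦ query | output`, run by `OracleAlg.runAux`) and of
`LazySampling.lean`, whose runs layer it generalises from one-bit answers to string answers:
`LazySampling.lean` has `OracleAlg.runWith M x ans k as` — the run in which the query `u` asked
after the transcript `as` is answered by the single bit `ans as u` (Bennett–Gill's coin-flip
simulator answers bits) — with its dynamics `nextT`, transcripts `traceT`, the locality principle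
`traceT_congr` and the history-free case `runAux_ofLanguage`. The GGM hybrid argument
(`Cryptography/GGMHybridRuns.lean`: the answers are `n`-bit labels) needs the same layer for rules
`ans : List (List Bool) → List Bool → List Bool` answering STRINGS:

* `OracleAlg.runRule M x ans k E`, `OracleAlg.nextR`, `OracleAlg.traceR` — the string-valued twins
  of `runWith`/`nextT`/`traceT` (same recursion), with `runRule_succ_eq_outOf` (the run read off the
  iterated dynamics), `traceR_eq_iterate`, `traceR_prefix_of_le`, `length_traceR_le`, the locality
  principle `traceR_congr`/`runRule_congr`, `runRule_historyFree` (a history-free rule is an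
  oracle: `runRule = runAux`) and `runRule_clockBy` (the clocked algorithm of
  `OracleClockFst.lean` under a rule);
* the **bridge** to the one-bit layer: `runWith_eq_runRule`, `nextT_eq_nextR`, `traceT_eq_traceR`
  (the Bool versions are the instance `fun E u => [ans E u]`), so nothing there is restated;
* two lemmas on `LazySampling.lean`'s replay device `OracleAlg.queryAt` (the query asked at an
  earlier round, recomputed from the transcript prefix): `queryAt_of_prefix`,
  `queryAt_length_of_inl`.

## References

* S. Arora, B. Barak, *Computational Complexity: A Modern Approach*, CUP 2009, §3.4 (oracle
  machines: the configuration after `i` answers is determined by the input and those answers).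
* O. Goldreich, *Foundations of Cryptography I*, CUP 2001, proof of Claim 3.6.6.1 (pp. 190–192:
  the interleaved processes `ρ` (queries) and `ψ` (answers)).
* C. H. Bennett, J. Gill, SIAM J. Comput. 10 (1981) — the one-bit case (`LazySampling.lean`).
-/

namespace Literature.Computability.Complexity

open _root_.Computability

namespace OracleAlg

variable {β : Type}

/-! ### Runs of a transcript algorithm under a history-dependent answer rule -/

/-- An *answer rule*: the answer to the query `u` asked after the transcript `E` of earlier
answers. [Goldreich 2001, proof of Claim 3.6.6.1 (the process `ψ`)] [folklore] -/
abbrev Rule : Type := List (List Bool) → List Bool → List Bool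

/-- `runRule M x ans k E`: run `M` on `x` for at most `k` rounds from the transcript `E`, the query
`u` asked after transcript `E'` being answered by `ans E' u`. [GGM 1986, p. 800 (the answering
algorithms `A_i`)] [folklore] -/
def runRule (M : OracleAlg β) (x : List Bool) (ans : Rule) : ℕ → List (List Bool) → Option β
  | 0, _ => none
  | k + 1, E =>
    match M.step x E with
    | Sum.inl u => runRule M x ans k (E ++ [ans E u])
    | Sum.inr b => some b

/-- One round of the transcript dynamics under the rule `ans` (frozen after an output). [folklore] -/
def nextR (M : OracleAlg β) (x : List Bool) (ans : Rule) (E : List (List Bool)) : List (List Bool) :=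
  match M.step x E with
  | Sum.inl u => E ++ [ans E u]
  | Sum.inr _ => E

/-- The transcript after `j` rounds under the rule `ans`. [folklore] -/
def traceR (M : OracleAlg β) (x : List Bool) (ans : Rule) : ℕ → List (List Bool)
  | 0 => []
  | j + 1 => nextR M x ans (traceR M x ans j)

/-- The output carried by a step result (`none` for a query). [folklore] -/
def outOf : List Bool ⊕ β → Option β
  | Sum.inl _ => none
  | Sum.inr b => some b

section Runs

variable (M : OracleAlg β) (x : List Bool) (ans : Rule)

/-- No rounds, no output. [folklore] -/
@[simp] theorem runRule_zero (E : List (List Bool)) : runRule M x ans 0 E = none := rfl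

/-- One round of `runRule`. [folklore] -/
theorem runRule_succ (k : ℕ) (E : List (List Bool)) :
    runRule M x ans (k + 1) E =
      (match M.step x E with
      | Sum.inl u => runRule M x ans k (E ++ [ans E u])
      | Sum.inr b => some b) :=
  rfl

/-- A query round appends the rule's answer. [folklore] -/
theorem nextR_of_inl {E : List (List Bool)} {u : List Bool} (h : M.step x E = Sum.inl u) :
    nextR M x ans E = E ++ [ans E u] := by
  simp [nextR, h]

/-- An output round freezes the transcript. [folklore] -/
theorem nextR_of_inr {E : List (List Bool)} {b : β} (h : M.step x E = Sum.inr b) :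
    nextR M x ans E = E := by
  simp [nextR, h]

/-- After an output the transcript stays frozen. [folklore] -/
theorem iterate_nextR_of_inr {E : List (List Bool)} {b : β} (h : M.step x E = Sum.inr b) :
    ∀ k : ℕ, (nextR M x ans)^[k] E = E
  | 0 => rfl
  | k + 1 => by
    rw [Function.iterate_succ_apply, nextR_of_inr M x ans h]
    exact iterate_nextR_of_inr h k

/-- **The run is read off the iterated dynamics**: within `k + 1` rounds from `E` the output is the
one reported by the step function at the `k`-th iterate of `nextR`. [folklore] -/
theorem runRule_succ_eq_outOf :
    ∀ (k : ℕ) (E : List (List Bool)),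
      runRule M x ans (k + 1) E = outOf (M.step x ((nextR M x ans)^[k] E))
  | 0, E => by
    rw [runRule_succ, Function.iterate_zero_apply]
    cases M.step x E with
    | inl u => rfl
    | inr b => rfl
  | k + 1, E => by
    rw [runRule_succ]
    cases h : M.step x E with
    | inl u =>
      simp only
      rw [runRule_succ_eq_outOf k, Function.iterate_succ_apply, nextR_of_inl M x ans h]
    | inr b =>
      simp only
      rw [iterate_nextR_of_inr M x ans h, h]
      rfl

/-- No transcript before the first round. [folklore] -/
@[simp] theorem traceR_zero : traceR M x ans 0 = [] := rfl

/-- One more round applies the dynamics. [folklore] -/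
theorem traceR_succ (j : ℕ) : traceR M x ans (j + 1) = nextR M x ans (traceR M x ans j) := rfl

/-- The transcript after `j` rounds is the `j`-th iterate of the dynamics. [folklore] -/
theorem traceR_eq_iterate : ∀ j : ℕ, traceR M x ans j = (nextR M x ans)^[j] []
  | 0 => rfl
  | j + 1 => by
    rw [traceR_succ, traceR_eq_iterate j, ← Function.iterate_succ_apply' (nextR M x ans)]

/-- **The run from the empty transcript** within `k + 1` rounds outputs what the step function
reports at the transcript after `k` rounds. [folklore] -/
theorem runRule_nil_succ (k : ℕ) :
    runRule M x ans (k + 1) [] = outOf (M.step x (traceR M x ans k)) := by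
  rw [runRule_succ_eq_outOf, traceR_eq_iterate]

/-- The transcript only grows: round `j`'s transcript is a prefix of round `j + 1`'s. [folklore] -/
theorem traceR_prefix_succ (j : ℕ) : traceR M x ans j <+: traceR M x ans (j + 1) := by
  rw [traceR_succ]
  unfold nextR
  cases M.step x (traceR M x ans j) with
  | inl u => exact List.prefix_append _ _
  | inr b => exact List.prefix_rfl

/-- Transcripts are monotone in the number of rounds. [folklore] -/
theorem traceR_prefix_of_le {j j' : ℕ} (h : j ≤ j') : traceR M x ans j <+: traceR M x ans j' := by
  induction h with
  | refl => exact List.prefix_rfl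
  | step _ ih => exact ih.trans (traceR_prefix_succ M x ans _)

/-- At most one answer per round. [folklore] -/
theorem length_traceR_le : ∀ j : ℕ, (traceR M x ans j).length ≤ j
  | 0 => le_rfl
  | j + 1 => by
    rw [traceR_succ]
    unfold nextR
    cases M.step x (traceR M x ans j) with
    | inl u => simpa using length_traceR_le j
    | inr b => exact (length_traceR_le j).trans (Nat.le_succ j)

/-- A query round within the budget leaves a strictly longer transcript. [folklore] -/
theorem length_traceR_succ_of_inl {j : ℕ} {u : List Bool}
    (h : M.step x (traceR M x ans j) = Sum.inl u) :
    (traceR M x ans (j + 1)).length = (traceR M x ans j).length + 1 := by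
  rw [traceR_succ, nextR_of_inl M x ans h, List.length_append, List.length_singleton]

/-- **Locality**: two rules that agree on every query asked along the transcript of the first
(before round `k`) produce the same transcripts up to round `k`. [Goldreich 2001, proof of
Claim 3.6.6.1 (the process `ρ` sees only the answers)] [folklore] -/
theorem traceR_congr {ans₁ ans₂ : Rule} (k : ℕ)
    (h : ∀ j < k, ∀ u, M.step x (traceR M x ans₁ j) = Sum.inl u →
      ans₁ (traceR M x ans₁ j) u = ans₂ (traceR M x ans₁ j) u) :
    ∀ j ≤ k, traceR M x ans₁ j = traceR M x ans₂ j
  | 0, _ => rfl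
  | j + 1, hj => by
    have ih := traceR_congr k h j (Nat.le_of_succ_le hj)
    rw [traceR_succ, traceR_succ, ← ih]
    unfold nextR
    cases hs : M.step x (traceR M x ans₁ j) with
    | inl u =>
      simp only
      rw [h j (Nat.lt_of_succ_le hj) u hs]
    | inr b => rfl

/-- **Locality for runs**: two rules agreeing along the transcript of the first give the same
output within `k` rounds. [folklore] -/
theorem runRule_congr {ans₁ ans₂ : Rule} (k : ℕ)
    (h : ∀ j < k, ∀ u, M.step x (traceR M x ans₁ j) = Sum.inl u →
      ans₁ (traceR M x ans₁ j) u = ans₂ (traceR M x ans₁ j) u) :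
    runRule M x ans₁ k [] = runRule M x ans₂ k [] := by
  cases k with
  | zero => rfl
  | succ k =>
    rw [runRule_nil_succ, runRule_nil_succ,
      traceR_congr M x k (fun j hj => h j (Nat.lt_succ_of_lt hj)) k le_rfl]

/-- **A history-free rule is an oracle**: `runRule` with the rule `(E, u) ↦ O u` is G01's runner
`OracleAlg.runAux`. [Arora–Barak 2009, §3.4] [folklore] -/
theorem runRule_historyFree (O : Oracle) :
    ∀ (k : ℕ) (E : List (List Bool)), runRule M x (fun _ u => O u) k E = M.runAux O x k E
  | 0, _ => rfl
  | k + 1, E => by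
    rw [runRule_succ, OracleAlg.runAux_succ]
    cases M.step x E with
    | inl u => exact runRule_historyFree O k _
    | inr b => rfl

/-- **The clocked algorithm under a rule** (`OracleAlg.clockBy`, `OracleClockFst.lean`): with more
fuel than the clock leaves, `M.clockBy c b₀` outputs what `M` outputs within the remaining
`c x - |E|` rounds, and `b₀` if `M` does not halt by then. [Arora–Barak 2009, §3.4 with §1.4.1] [folklore] -/
theorem runRule_clockBy (c : List Bool → ℕ) (b₀ : β) :
    ∀ (n : ℕ) (E : List (List Bool)), E.length ≤ c x → c x - E.length < n →
      runRule (M.clockBy c b₀) x ans n E = some ((runRule M x ans (c x - E.length) E).getD b₀)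
  | 0, _, _, h => absurd h (Nat.not_lt_zero _)
  | n + 1, E, hle, hlt => by
    rw [runRule_succ, OracleAlg.clockBy_step]
    by_cases hc : E.length < c x
    · rw [if_pos hc]
      obtain ⟨m, hm⟩ : ∃ m, c x - E.length = m + 1 := ⟨c x - E.length - 1, by omega⟩
      rw [hm, runRule_succ]
      cases M.step x E with
      | inr b => rfl
      | inl y =>
        have h1 : (E ++ [ans E y]).length ≤ c x := by simp; omega
        have h2 : c x - (E ++ [ans E y]).length < n := by simp; omega
        have h3 : c x - (E ++ [ans E y]).length = m := by simp; omega
        simp only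
        rw [runRule_clockBy c b₀ n _ h1 h2, h3]
    · rw [if_neg hc]
      have h0 : c x - E.length = 0 := by omega
      rw [h0, runRule_zero]
      rfl

end Runs

/-! ### Bridge to the one-bit layer of `LazySampling.lean` -/

section Bridge

variable (M : OracleAlg β) (x : List Bool) (a : List (List Bool) → List Bool → Bool)

/-- **`runWith` is `runRule` for the one-bit rule `[a E u]`.** [folklore] -/
theorem runWith_eq_runRule : ∀ (k : ℕ) (E : List (List Bool)),
    runWith M x a k E = runRule M x (fun E u => [a E u]) k E
  | 0, _ => rfl
  | k + 1, E => by
    rw [runWith, runRule_succ]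
    cases M.step x E with
    | inl u => exact runWith_eq_runRule k _
    | inr b => rfl

/-- `nextT` is `nextR` for the one-bit rule. [folklore] -/
theorem nextT_eq_nextR (E : List (List Bool)) : nextT M x a E = nextR M x (fun E u => [a E u]) E := rfl

/-- `traceT` is `traceR` for the one-bit rule. [folklore] -/
theorem traceT_eq_traceR : ∀ j : ℕ, traceT M x a j = traceR M x (fun E u => [a E u]) j
  | 0 => rfl
  | j + 1 => by rw [traceT, traceR_succ, traceT_eq_traceR j, nextT_eq_nextR]

end Bridge

/-! ### The replay device `queryAt` along prefixes -/

section QueryAt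

variable (M : OracleAlg β) (x : List Bool)

/-- `queryAt` only reads the first `k` answers. [folklore] -/
theorem queryAt_of_prefix {E E' : List (List Bool)} (h : E <+: E') {k : ℕ} (hk : k ≤ E.length) :
    queryAt M x E' k = queryAt M x E k := by
  obtain ⟨s, rfl⟩ := h
  unfold queryAt
  rw [List.take_append_of_le_length hk]

/-- The query at the current round `|E|` is the one the step function asks on `E`. [folklore] -/
theorem queryAt_length_of_inl {E : List (List Bool)} {u : List Bool} (h : M.step x E = Sum.inl u) :
    queryAt M x E E.length = some u := by
  unfold queryAt
  rw [List.take_length, h]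

end QueryAt

end OracleAlg

end Literature.Computability.Complexity
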